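import Summits.BirchSwinnertonDyer.BirchSwinnertonDyer.Theorems.KolyvaginDepthDoorDepthTableKurihara
import Summits.BirchSwinnertonDyer.BirchSwinnertonDyer.Theorems.KolyvaginDepthDoorDepthTableSteinWuthrichRows9
import Summits.BirchSwinnertonDyer.BirchSwinnertonDyer.Theorems.KolyvaginDepthDoorDepthTableRankTwo997c1TwistBSDQuotientUniform
import Summits.BirchSwinnertonDyer.BirchSwinnertonDyer.Theorems.KolyvaginDepthDoorDepthTableSteinWuthrichRows6
import Summits.BirchSwinnertonDyer.BirchSwinnertonDyer.Theorems.KolyvaginDepthDoorDepthTableRankTwo655a1TwistBSDQuotientUniform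
import Summits.BirchSwinnertonDyer.BirchSwinnertonDyer.Theorems.KolyvaginDepthDoorDepthTableSteinWuthrichRows5
import Summits.BirchSwinnertonDyer.BirchSwinnertonDyer.Theorems.KolyvaginDepthDoorDepthTableRowsIntrinsic4
import Summits.BirchSwinnertonDyer.BirchSwinnertonDyer.Theorems.KolyvaginDepthDoorDepthTableKolyvaginPrimes2
import Summits.BirchSwinnertonDyer.Rank1Residual.Supersingular.CountPointsFast
import Summits.BirchSwinnertonDyer.Rank1Residual.Additive.X4ThreeKuriharaCertKernel
import HarnessLib

/-!
# Route `KolyvaginDepthDoor`, crux `KolyvaginDepthSupplyKN` (stmt-BirchSwinnertonDyer-22820) —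
# DEPTH TABLE v17, E-SIDE TABLE (part 5: `997c1`, `655a1`, `707a1`): `Ш(E/ℚ)[p] = 0` at an admissible `p ∈ {7, 11}` from the
# TREE'S OWN Kurihara records (Kim 2026 Thm. 1.11 by name) — the curves of the table that are anomalous or non-cyclic at `5`

Helper file of the lead prover of line `levelone` (kdd-p1 g21; `--supports stmt-BirchSwinnertonDyer-22820
--as helper`); it closes nothing and BSD is NOT proved by it.

Sequel of `KolyvaginDepthDoorDepthTableKuriharaESideFive1/2`. For the curves below `5` is unusable for Kim's Thm. 1.11 (`a_5 ≡ 1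
(mod 5)` — hypothesis (iii) —, or the record's level at `5` has a prime with `25 ∣ #Ẽ(𝔽_ℓ)`), but the tree ALSO holds their
Kurihara records at `p ∈ {7, 11, 13}` (`ν = 2`); at the prime used here every hypothesis is decided in the kernel: `p` good
ordinary and non-anomalous, `ρ̄_{E,p}` onto (semistable + Mazur's Frobenius no-root witness, Serre Prop. 21), the level
`ℓ₁ℓ₂ ∈ 𝒩₁(E, p)` with cyclic `p`-parts (`countPointsFast`), Kodaira–Néron at `p` (lineage `kodairaNeron_of_five_le`),
`2 ≤ rank_ℤ E(ℚ)` (observatory kernel certificates):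

* `997c1` = `[0, -1, 1, -24, 54]` at `p = 7`: record `(7, 43·239 = 10277, 2, 3)` (`RecordsN000988to000999`); `#Ẽ(𝔽_43) = 56`, `#Ẽ(𝔽_239) = 224`; `a_7 = -4`; surjectivity witness `a_5 = -2`
* `655a1` = `[0, 0, 1, -13, 18]` at `p = 11`: record `(11, 617·727 = 448559, 2, 5)` (`RecordsN000651to000685`); `#Ẽ(𝔽_617) = 594`, `#Ẽ(𝔽_727) = 748`; `a_11 = -4`; surjectivity witness `a_17 = -2`
* `707a1` = `[0, 1, 1, -12, 12]` at `p = 11`: record `(11, 463·1277 = 591251, 2, 3)` (`RecordsN000688to000715`); `#Ẽ(𝔽_463) = 440`, `#Ẽ(𝔽_1277) = 1320`; `a_11 = -4`; surjectivity witness `a_439 = -20`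

RESULT per curve (`C<label>.sha_inf_torsionBy_eq_bot_of_kuriharaClaim_<p>`): `Ш(E/ℚ)[p] = 0` — X1 at `p`, torsion level —
CONDITIONAL on Kim 2026 Thm. 1.11, modularity, Mazur 1978 Cor. 4.1 BY NAME and the record's CLAIM (`hδ`, read at level `N_E`
through `KuriharaCertificates.Record.Claim`). With the `p = 5` files and the `389a1`/`433a1` row files the `E`-side conjunct of
the depth table is certificate-backed for 17 of the 18 rank-two curves of conductor `≤ 1000` (`664a1`, additive at `2`, would
need Serre Prop. 19 witnesses). Per curve; nothing class-wide; BSD is NOT proved by any of this.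

References: [Kim2022StructureSelmer] Thm. 1.11; [Mazur1978] Cor. 4.1, Prop. 6.3 (1); [Serre1972] Prop. 21; [SilvermanAEC2009] VII.3.1.
-/

set_option linter.dupNamespace false

noncomputable section

open scoped Classical NumberField

namespace Summit.BirchSwinnertonDyer.BirchSwinnertonDyer.Theorems.KolyvaginDepthDoor

open Literature.NumberTheory.EllipticCurves Literature.NumberTheory.EllipticCurves.ModularForms
  WeierstrassCurve NumberField IsDedekindDomain
open Summit.BirchSwinnertonDyer.BirchSwinnertonDyer.Theorems
open Summit.BirchSwinnertonDyer.BirchSwinnertonDyer.Rank2Observatory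
open Summit.BirchSwinnertonDyer.BirchSwinnertonDyer.Rank1Residual (IntModel.frobeniusTrace_eq)
open Summit.BirchSwinnertonDyer.Rank1Residual.Supersingular (natCard_point_eq_of_countPoints countPoints_eq_of_fast)
open Summit.BirchSwinnertonDyer.Rank1Residual.Additive (card_torsion_le_of_intModel_of_card
  isKolyvaginPrime_of_intModel_of_card isKolyvaginProduct_mul)

/-! ## `997c1` = `[0, -1, 1, -24, 54]` at `p = 7`: record `cert_997c1` @ `(7, 43·239)`, `δ̃ ≡ 3` -/

namespace C997c1

/-- `#Ẽ(𝔽_43) = 56` for `997c1` (`43 ≡ 1`, `a_43 = -12 ≡ 2 (mod 7)`, `7² ∤ 56`), kernel-decided (`countPointsFast`). [cite: CremonaAlgorithms1997, Table 1 (997c1)] -/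
theorem card_43 :
    Nat.card (((⟨0, -1, 1, -24, 54⟩ : WeierstrassCurve ℤ).map (Int.castRingHom (ZMod 43))).toAffine.Point) = 56 :=
  haveI : Fact (Nat.Prime 43) := ⟨by norm_num⟩
  natCard_point_eq_of_countPoints 0 (-1) 1 (-24) 54 43 (by norm_num) (by decide +kernel) (n := 56)
    (countPoints_eq_of_fast (by decide +kernel))

/-- `#Ẽ(𝔽_239) = 224` for `997c1` (`239 ≡ 1`, `a_239 = 16 ≡ 2 (mod 7)`, `7² ∤ 224`), kernel-decided (`countPointsFast`). [cite: CremonaAlgorithms1997, Table 1 (997c1)] -/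
theorem card_239 :
    Nat.card (((⟨0, -1, 1, -24, 54⟩ : WeierstrassCurve ℤ).map (Int.castRingHom (ZMod 239))).toAffine.Point) = 224 :=
  haveI : Fact (Nat.Prime 239) := ⟨by norm_num⟩
  natCard_point_eq_of_countPoints 0 (-1) 1 (-24) 54 239 (by norm_num) (by decide +kernel) (n := 224)
    (countPoints_eq_of_fast (by decide +kernel))

/-- **`7` is good ordinary for `997c1`** (`7 ∤ Δ`, `a_7 = -4`). [cite: CremonaAlgorithms1997, Table 1 (997c1)] -/
theorem goodOrdinary_7 :
    haveI := Fact.mk (by norm_num : Nat.Prime 7); haveI := isGloballyMinimal_c997c1;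
    ((⟨0, -1, 1, -24, 54⟩ : WeierstrassCurve ℤ).map (Int.castRingHom ℚ)).HasGoodReductionAtPrime 7 ∧ ¬ ((7 : ℕ) : ℤ) ∣ ((⟨0, -1, 1, -24, 54⟩ : WeierstrassCurve ℤ).map (Int.castRingHom ℚ)).frobeniusTrace 7 := by
  haveI := Fact.mk (by norm_num : Nat.Prime 7)
  haveI := isElliptic_c997c1
  haveI := isGloballyMinimal_c997c1
  exact goodOrdinary_of_intModel_certificate intModel 7 (by decide +kernel) (n := 12) card_7 (by decide +kernel)

/-- **`ρ̄_{E,7}` is surjective for `997c1`**: semistable (`gcd(c₄, Δ) = 1`) and `X² − (-2)X + 5` (`a_5 = -2`) has no root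
mod `7` (Mazur Prop. 6.3 (1) ⟹ `E[7]` irreducible; Serre Prop. 21 ⟹ onto). [cite: Serre1972, §5.4 Prop. 21] [cite: Mazur1978, §6 Prop. 6.3 (1)] -/
theorem hasSurjectiveModNGaloisRep_7 :
    haveI := isElliptic_c997c1;
    ((⟨0, -1, 1, -24, 54⟩ : WeierstrassCurve ℤ).map (Int.castRingHom ℚ)).HasSurjectiveModNGaloisRep (7 : ℕ) := by
  have hn : ∀ t : ZMod 7, t ^ 2 - (((5 : ℕ) : ℤ) + 1 - (8 : ℕ) : ℤ) * t + ((5 : ℕ) : ZMod 7) ≠ 0 := by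
    decide +kernel
  haveI := Fact.mk (by norm_num : Nat.Prime 7); haveI := Fact.mk (by norm_num : Nat.Prime 5)
  haveI := isElliptic_c997c1; haveI := isGloballyMinimal_c997c1
  exact hasSurjectiveModNGaloisRep_of_intModel_certificate intModel
    (by rw [Int.isCoprime_iff_gcd_eq_one]; decide +kernel) 7 5 (by norm_num) (by decide +kernel)
    (n := 8) card_5 hn

/-- **`7` is non-anomalous for `997c1`**: `a_7 − 1 = -5`. [cite: SilvermanAEC2009, VII.3 Prop. 3.1] -/
theorem nonAnomalous_7 :
    haveI := isGloballyMinimal_c997c1; haveI := Fact.mk (by norm_num : Nat.Prime 7);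
    ¬ ((7 : ℕ) : ℤ) ∣ ((⟨0, -1, 1, -24, 54⟩ : WeierstrassCurve ℤ).map (Int.castRingHom ℚ)).frobeniusTrace 7 - 1 := by
  haveI := isElliptic_c997c1; haveI := isGloballyMinimal_c997c1; haveI := Fact.mk (by norm_num : Nat.Prime 7)
  rw [IntModel.frobeniusTrace_eq intModel card_7]
  decide

/-- **`10277 = 43·239` is a cyclic Kolyvagin level for `(997c1, 7)`** — the level of the tree record `cert_997c1` at `p = 7`.
[cite: Kim2022StructureSelmer, §1.2.2 (PDF p. 5)] -/
theorem isCyclicKolyvaginLevel_7_10277 :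
    haveI := isGloballyMinimal_c997c1; haveI := Fact.mk (by norm_num : Nat.Prime 7);
    IsCyclicKolyvaginLevel ((⟨0, -1, 1, -24, 54⟩ : WeierstrassCurve ℤ).map (Int.castRingHom ℚ)) 7 10277 := by
  haveI := isElliptic_c997c1
  haveI := isGloballyMinimal_c997c1
  haveI := Fact.mk (by norm_num : Nat.Prime 7)
  haveI : Fact (Nat.Prime 43) := ⟨by norm_num⟩
  haveI : Fact (Nat.Prime 239) := ⟨by norm_num⟩
  have h₁ : Kato.IsKolyvaginPrime ((⟨0, -1, 1, -24, 54⟩ : WeierstrassCurve ℤ).map (Int.castRingHom ℚ)) 7 1 43 :=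
    isKolyvaginPrime_of_intModel_of_card intModel 7 1 43 (by norm_num) (by decide +kernel) (by decide) card_43
      (by norm_num)
  have h₂ : Kato.IsKolyvaginPrime ((⟨0, -1, 1, -24, 54⟩ : WeierstrassCurve ℤ).map (Int.castRingHom ℚ)) 7 1 239 :=
    isKolyvaginPrime_of_intModel_of_card intModel 7 1 239 (by norm_num) (by decide +kernel) (by decide) card_239
      (by norm_num)
  refine ⟨by simpa using isKolyvaginProduct_mul h₁ h₂ (by norm_num), fun ℓ hℓ hdvd ↦ ?_⟩
  rw [show (10277 : ℕ) = 43 * 239 from rfl] at hdvd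
  rcases (Nat.Prime.dvd_mul hℓ.out).mp hdvd with h | h
  · obtain rfl := (Nat.prime_dvd_prime_iff_eq hℓ.out (by norm_num)).mp h
    exact card_torsion_le_of_intModel_of_card intModel 7 43 card_43 (by norm_num)
  · obtain rfl := (Nat.prime_dvd_prime_iff_eq hℓ.out (by norm_num)).mp h
    exact card_torsion_le_of_intModel_of_card intModel 7 239 card_239 (by norm_num)

/-- **`Ш(997c1/ℚ)[7] = 0` FROM THE TREE RECORD `cert_997c1` @ `(7, 43·239)`** (Kurihara currency): granted Kim 2026 Thm. 1.11
(`hKim`), modularity (`hnf`), Mazur 1978 Cor. 4.1 (`hMaz`) BY NAME and the record's CLAIM `hδ` (read at level `N_E` through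
`KuriharaCertificates.Record.Claim`), `#Sel_7(E/ℚ) ≤ 7² = 7^rank` and so `Ш(E/ℚ)[7] = 0` (`7` good ordinary `goodOrdinary_7`,
`ρ̄_{E,7}` onto `hasSurjectiveModNGaloisRep_7`, `nonAnomalous_7`, Kodaira–Néron `kodairaNeron_of_five_le 7`, `2 ≤ rank` `KernelCerts003.C997c1.two_le_rank`).
CONDITIONAL on the three named facts and the claim; per curve; BSD is not proved by it.
[cite: Kim2022StructureSelmer, Thm. 1.11 (PDF p. 8)] [cite: Mazur1978, Cor. 4.1] [cite: CremonaAlgorithms1997, Table 1 (997c1)] -/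
theorem sha_inf_torsionBy_eq_bot_of_kuriharaClaim_7
    (hKim : Kim2022_card_selmerGroup_le_pow_of_kuriharaNumber_ne_zero)
    (hnf : exists_isNewformOf) (hMaz : mazur_not_dvd_maninConstant_of_odd)
    (hδ : haveI := isElliptic_c997c1; haveI := isGloballyMinimal_c997c1;
      haveI : NeZero (((⟨0, -1, 1, -24, 54⟩ : WeierstrassCurve ℤ).map (Int.castRingHom ℚ)).conductorNorm ℤ) := neZero_conductorNorm_of_isElliptic _;
      haveI := Fact.mk (by norm_num : Nat.Prime 7);
      ∀ (D : ModularParametrizationData ((⟨0, -1, 1, -24, 54⟩ : WeierstrassCurve ℤ).map (Int.castRingHom ℚ)) (((⟨0, -1, 1, -24, 54⟩ : WeierstrassCurve ℤ).map (Int.castRingHom ℚ)).conductorNorm ℤ)), ¬ ((7 : ℕ) : ℤ) ∣ D.maninConstant →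
        (∃ u : ℚ, ‖(u : ℚ_[7])‖ = 1 ∧ ((⟨0, -1, 1, -24, 54⟩ : WeierstrassCurve ℤ).map (Int.castRingHom ℚ)).realPeriodRat = u * plusPeriod D.f) →
        ∃ ψ : (ℓ : ℕ) → (ZMod ℓ)ˣ →* Multiplicative (ZMod 7),
          (∀ ℓ ∈ (10277 : ℕ).primeFactors, Function.Surjective (ψ ℓ)) ∧ kuriharaNumber D.f 7 10277 ψ ≠ 0) :
    haveI := isElliptic_c997c1; haveI := isGloballyMinimal_c997c1; haveI := Fact.mk (by norm_num : Nat.Prime 7);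
    (((⟨0, -1, 1, -24, 54⟩ : WeierstrassCurve ℤ).map (Int.castRingHom ℚ)).sha ⊓ AddSubgroup.torsionBy ((⟨0, -1, 1, -24, 54⟩ : WeierstrassCurve ℤ).map (Int.castRingHom ℚ)).galH1 ((7 : ℕ) : ℤ) : AddSubgroup _) = ⊥ := by
  haveI := isElliptic_c997c1
  haveI := isGloballyMinimal_c997c1
  haveI iNZ : NeZero (((⟨0, -1, 1, -24, 54⟩ : WeierstrassCurve ℤ).map (Int.castRingHom ℚ)).conductorNorm ℤ) := neZero_conductorNorm_of_isElliptic _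
  haveI := Fact.mk (by norm_num : Nat.Prime 7)
  haveI : NeZero (10277 : ℕ) := ⟨by norm_num⟩
  have hν : (10277 : ℕ).primeFactors.card ≤ ((⟨0, -1, 1, -24, 54⟩ : WeierstrassCurve ℤ).map (Int.castRingHom ℚ)).mordellWeilRank := by
    refine le_trans (le_of_eq ?_) KernelCerts003.C997c1.two_le_rank
    rw [show (10277 : ℕ) = 43 * 239 from rfl, Nat.primeFactors_mul (by norm_num) (by norm_num),
      Nat.Prime.primeFactors (by norm_num), Nat.Prime.primeFactors (by norm_num)]
    decide
  exact sha_inf_torsionBy_eq_bot_of_kuriharaClaim hKim hnf hMaz _ 7 (by norm_num) goodOrdinary_7.1 goodOrdinary_7.2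
    hasSurjectiveModNGaloisRep_7 nonAnomalous_7 (kodairaNeron_of_five_le 7 (by norm_num)) 10277 isCyclicKolyvaginLevel_7_10277 hν hδ

end C997c1

/-! ## `655a1` = `[0, 0, 1, -13, 18]` at `p = 11`: record `cert_655a1` @ `(11, 617·727)`, `δ̃ ≡ 5` -/

namespace C655a1

/-- `#Ẽ(𝔽_11) = 16` for `655a1` (`a_11 = -4`: good ordinary, non-anomalous at `11`), kernel-decided (`countPointsFast`). [cite: CremonaAlgorithms1997, Table 1 (655a1)] -/
theorem card_11 :
    Nat.card (((⟨0, 0, 1, -13, 18⟩ : WeierstrassCurve ℤ).map (Int.castRingHom (ZMod 11))).toAffine.Point) = 16 :=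
  haveI : Fact (Nat.Prime 11) := ⟨by norm_num⟩
  natCard_point_eq_of_countPoints 0 0 1 (-13) 18 11 (by norm_num) (by decide +kernel) (n := 16)
    (countPoints_eq_of_fast (by decide +kernel))

/-- `#Ẽ(𝔽_617) = 594` for `655a1` (`617 ≡ 1`, `a_617 = 24 ≡ 2 (mod 11)`, `11² ∤ 594`), kernel-decided (`countPointsFast`). [cite: CremonaAlgorithms1997, Table 1 (655a1)] -/
theorem card_617 :
    Nat.card (((⟨0, 0, 1, -13, 18⟩ : WeierstrassCurve ℤ).map (Int.castRingHom (ZMod 617))).toAffine.Point) = 594 :=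
  haveI : Fact (Nat.Prime 617) := ⟨by norm_num⟩
  natCard_point_eq_of_countPoints 0 0 1 (-13) 18 617 (by norm_num) (by decide +kernel) (n := 594)
    (countPoints_eq_of_fast (by decide +kernel))

/-- `#Ẽ(𝔽_727) = 748` for `655a1` (`727 ≡ 1`, `a_727 = -20 ≡ 2 (mod 11)`, `11² ∤ 748`), kernel-decided (`countPointsFast`). [cite: CremonaAlgorithms1997, Table 1 (655a1)] -/
theorem card_727 :
    Nat.card (((⟨0, 0, 1, -13, 18⟩ : WeierstrassCurve ℤ).map (Int.castRingHom (ZMod 727))).toAffine.Point) = 748 :=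
  haveI : Fact (Nat.Prime 727) := ⟨by norm_num⟩
  natCard_point_eq_of_countPoints 0 0 1 (-13) 18 727 (by norm_num) (by decide +kernel) (n := 748)
    (countPoints_eq_of_fast (by decide +kernel))

/-- **`11` is good ordinary for `655a1`** (`11 ∤ Δ`, `a_11 = -4`). [cite: CremonaAlgorithms1997, Table 1 (655a1)] -/
theorem goodOrdinary_11 :
    haveI := Fact.mk (by norm_num : Nat.Prime 11); haveI := isGloballyMinimal_c655a1;
    ((⟨0, 0, 1, -13, 18⟩ : WeierstrassCurve ℤ).map (Int.castRingHom ℚ)).HasGoodReductionAtPrime 11 ∧ ¬ ((11 : ℕ) : ℤ) ∣ ((⟨0, 0, 1, -13, 18⟩ : WeierstrassCurve ℤ).map (Int.castRingHom ℚ)).frobeniusTrace 11 := by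
  haveI := Fact.mk (by norm_num : Nat.Prime 11)
  haveI := isElliptic_c655a1
  haveI := isGloballyMinimal_c655a1
  exact goodOrdinary_of_intModel_certificate intModel 11 (by decide +kernel) (n := 16) card_11 (by decide +kernel)

/-- **`ρ̄_{E,11}` is surjective for `655a1`**: semistable (`gcd(c₄, Δ) = 1`) and `X² − (-2)X + 17` (`a_17 = -2`) has no root
mod `11` (Mazur Prop. 6.3 (1) ⟹ `E[11]` irreducible; Serre Prop. 21 ⟹ onto). [cite: Serre1972, §5.4 Prop. 21] [cite: Mazur1978, §6 Prop. 6.3 (1)] -/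
theorem hasSurjectiveModNGaloisRep_11 :
    haveI := isElliptic_c655a1;
    ((⟨0, 0, 1, -13, 18⟩ : WeierstrassCurve ℤ).map (Int.castRingHom ℚ)).HasSurjectiveModNGaloisRep (11 : ℕ) := by
  have hn : ∀ t : ZMod 11, t ^ 2 - (((17 : ℕ) : ℤ) + 1 - (20 : ℕ) : ℤ) * t + ((17 : ℕ) : ZMod 11) ≠ 0 := by
    decide +kernel
  haveI := Fact.mk (by norm_num : Nat.Prime 11); haveI := Fact.mk (by norm_num : Nat.Prime 17)
  haveI := isElliptic_c655a1; haveI := isGloballyMinimal_c655a1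
  exact hasSurjectiveModNGaloisRep_of_intModel_certificate intModel
    (by rw [Int.isCoprime_iff_gcd_eq_one]; decide +kernel) 11 17 (by norm_num) (by decide +kernel)
    (n := 20) card_17 hn

/-- **`11` is non-anomalous for `655a1`**: `a_11 − 1 = -5`. [cite: SilvermanAEC2009, VII.3 Prop. 3.1] -/
theorem nonAnomalous_11 :
    haveI := isGloballyMinimal_c655a1; haveI := Fact.mk (by norm_num : Nat.Prime 11);
    ¬ ((11 : ℕ) : ℤ) ∣ ((⟨0, 0, 1, -13, 18⟩ : WeierstrassCurve ℤ).map (Int.castRingHom ℚ)).frobeniusTrace 11 - 1 := by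
  haveI := isElliptic_c655a1; haveI := isGloballyMinimal_c655a1; haveI := Fact.mk (by norm_num : Nat.Prime 11)
  rw [IntModel.frobeniusTrace_eq intModel card_11]
  decide

/-- **`448559 = 617·727` is a cyclic Kolyvagin level for `(655a1, 11)`** — the level of the tree record `cert_655a1` at `p = 11`.
[cite: Kim2022StructureSelmer, §1.2.2 (PDF p. 5)] -/
theorem isCyclicKolyvaginLevel_11_448559 :
    haveI := isGloballyMinimal_c655a1; haveI := Fact.mk (by norm_num : Nat.Prime 11);
    IsCyclicKolyvaginLevel ((⟨0, 0, 1, -13, 18⟩ : WeierstrassCurve ℤ).map (Int.castRingHom ℚ)) 11 448559 := by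
  haveI := isElliptic_c655a1
  haveI := isGloballyMinimal_c655a1
  haveI := Fact.mk (by norm_num : Nat.Prime 11)
  haveI : Fact (Nat.Prime 617) := ⟨by norm_num⟩
  haveI : Fact (Nat.Prime 727) := ⟨by norm_num⟩
  have h₁ : Kato.IsKolyvaginPrime ((⟨0, 0, 1, -13, 18⟩ : WeierstrassCurve ℤ).map (Int.castRingHom ℚ)) 11 1 617 :=
    isKolyvaginPrime_of_intModel_of_card intModel 11 1 617 (by norm_num) (by decide +kernel) (by decide) card_617
      (by norm_num)
  have h₂ : Kato.IsKolyvaginPrime ((⟨0, 0, 1, -13, 18⟩ : WeierstrassCurve ℤ).map (Int.castRingHom ℚ)) 11 1 727 :=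
    isKolyvaginPrime_of_intModel_of_card intModel 11 1 727 (by norm_num) (by decide +kernel) (by decide) card_727
      (by norm_num)
  refine ⟨by simpa using isKolyvaginProduct_mul h₁ h₂ (by norm_num), fun ℓ hℓ hdvd ↦ ?_⟩
  rw [show (448559 : ℕ) = 617 * 727 from rfl] at hdvd
  rcases (Nat.Prime.dvd_mul hℓ.out).mp hdvd with h | h
  · obtain rfl := (Nat.prime_dvd_prime_iff_eq hℓ.out (by norm_num)).mp h
    exact card_torsion_le_of_intModel_of_card intModel 11 617 card_617 (by norm_num)
  · obtain rfl := (Nat.prime_dvd_prime_iff_eq hℓ.out (by norm_num)).mp h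
    exact card_torsion_le_of_intModel_of_card intModel 11 727 card_727 (by norm_num)

/-- **`Ш(655a1/ℚ)[11] = 0` FROM THE TREE RECORD `cert_655a1` @ `(11, 617·727)`** (Kurihara currency): granted Kim 2026 Thm. 1.11
(`hKim`), modularity (`hnf`), Mazur 1978 Cor. 4.1 (`hMaz`) BY NAME and the record's CLAIM `hδ` (read at level `N_E` through
`KuriharaCertificates.Record.Claim`), `#Sel_11(E/ℚ) ≤ 11² = 11^rank` and so `Ш(E/ℚ)[11] = 0` (`11` good ordinary `goodOrdinary_11`,
`ρ̄_{E,11}` onto `hasSurjectiveModNGaloisRep_11`, `nonAnomalous_11`, Kodaira–Néron `kodairaNeron_of_five_le 11`, `2 ≤ rank` `KernelCerts001.C655a1.two_le_rank`).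
CONDITIONAL on the three named facts and the claim; per curve; BSD is not proved by it.
[cite: Kim2022StructureSelmer, Thm. 1.11 (PDF p. 8)] [cite: Mazur1978, Cor. 4.1] [cite: CremonaAlgorithms1997, Table 1 (655a1)] -/
theorem sha_inf_torsionBy_eq_bot_of_kuriharaClaim_11
    (hKim : Kim2022_card_selmerGroup_le_pow_of_kuriharaNumber_ne_zero)
    (hnf : exists_isNewformOf) (hMaz : mazur_not_dvd_maninConstant_of_odd)
    (hδ : haveI := isElliptic_c655a1; haveI := isGloballyMinimal_c655a1;
      haveI : NeZero (((⟨0, 0, 1, -13, 18⟩ : WeierstrassCurve ℤ).map (Int.castRingHom ℚ)).conductorNorm ℤ) := neZero_conductorNorm_of_isElliptic _;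
      haveI := Fact.mk (by norm_num : Nat.Prime 11);
      ∀ (D : ModularParametrizationData ((⟨0, 0, 1, -13, 18⟩ : WeierstrassCurve ℤ).map (Int.castRingHom ℚ)) (((⟨0, 0, 1, -13, 18⟩ : WeierstrassCurve ℤ).map (Int.castRingHom ℚ)).conductorNorm ℤ)), ¬ ((11 : ℕ) : ℤ) ∣ D.maninConstant →
        (∃ u : ℚ, ‖(u : ℚ_[11])‖ = 1 ∧ ((⟨0, 0, 1, -13, 18⟩ : WeierstrassCurve ℤ).map (Int.castRingHom ℚ)).realPeriodRat = u * plusPeriod D.f) →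
        ∃ ψ : (ℓ : ℕ) → (ZMod ℓ)ˣ →* Multiplicative (ZMod 11),
          (∀ ℓ ∈ (448559 : ℕ).primeFactors, Function.Surjective (ψ ℓ)) ∧ kuriharaNumber D.f 11 448559 ψ ≠ 0) :
    haveI := isElliptic_c655a1; haveI := isGloballyMinimal_c655a1; haveI := Fact.mk (by norm_num : Nat.Prime 11);
    (((⟨0, 0, 1, -13, 18⟩ : WeierstrassCurve ℤ).map (Int.castRingHom ℚ)).sha ⊓ AddSubgroup.torsionBy ((⟨0, 0, 1, -13, 18⟩ : WeierstrassCurve ℤ).map (Int.castRingHom ℚ)).galH1 ((11 : ℕ) : ℤ) : AddSubgroup _) = ⊥ := by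
  haveI := isElliptic_c655a1
  haveI := isGloballyMinimal_c655a1
  haveI iNZ : NeZero (((⟨0, 0, 1, -13, 18⟩ : WeierstrassCurve ℤ).map (Int.castRingHom ℚ)).conductorNorm ℤ) := neZero_conductorNorm_of_isElliptic _
  haveI := Fact.mk (by norm_num : Nat.Prime 11)
  haveI : NeZero (448559 : ℕ) := ⟨by norm_num⟩
  have hν : (448559 : ℕ).primeFactors.card ≤ ((⟨0, 0, 1, -13, 18⟩ : WeierstrassCurve ℤ).map (Int.castRingHom ℚ)).mordellWeilRank := by
    refine le_trans (le_of_eq ?_) KernelCerts001.C655a1.two_le_rank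
    rw [show (448559 : ℕ) = 617 * 727 from rfl, Nat.primeFactors_mul (by norm_num) (by norm_num),
      Nat.Prime.primeFactors (by norm_num), Nat.Prime.primeFactors (by norm_num)]
    decide
  exact sha_inf_torsionBy_eq_bot_of_kuriharaClaim hKim hnf hMaz _ 11 (by norm_num) goodOrdinary_11.1 goodOrdinary_11.2
    hasSurjectiveModNGaloisRep_11 nonAnomalous_11 (kodairaNeron_of_five_le 11 (by norm_num)) 448559 isCyclicKolyvaginLevel_11_448559 hν hδ

end C655a1

/-! ## `707a1` = `[0, 1, 1, -12, 12]` at `p = 11`: record `cert_707a1` @ `(11, 463·1277)`, `δ̃ ≡ 3` -/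

namespace C707a1

/-- `#Ẽ(𝔽_11) = 16` for `707a1` (`a_11 = -4`: good ordinary, non-anomalous at `11`), kernel-decided (`countPointsFast`). [cite: CremonaAlgorithms1997, Table 1 (707a1)] -/
theorem card_11 :
    Nat.card (((⟨0, 1, 1, -12, 12⟩ : WeierstrassCurve ℤ).map (Int.castRingHom (ZMod 11))).toAffine.Point) = 16 :=
  haveI : Fact (Nat.Prime 11) := ⟨by norm_num⟩
  natCard_point_eq_of_countPoints 0 1 1 (-12) 12 11 (by norm_num) (by decide +kernel) (n := 16)
    (countPoints_eq_of_fast (by decide +kernel))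

/-- `#Ẽ(𝔽_463) = 440` for `707a1` (`463 ≡ 1`, `a_463 = 24 ≡ 2 (mod 11)`, `11² ∤ 440`), kernel-decided (`countPointsFast`). [cite: CremonaAlgorithms1997, Table 1 (707a1)] -/
theorem card_463 :
    Nat.card (((⟨0, 1, 1, -12, 12⟩ : WeierstrassCurve ℤ).map (Int.castRingHom (ZMod 463))).toAffine.Point) = 440 :=
  haveI : Fact (Nat.Prime 463) := ⟨by norm_num⟩
  natCard_point_eq_of_countPoints 0 1 1 (-12) 12 463 (by norm_num) (by decide +kernel) (n := 440)
    (countPoints_eq_of_fast (by decide +kernel))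

/-- `#Ẽ(𝔽_1277) = 1320` for `707a1` (`1277 ≡ 1`, `a_1277 = -42 ≡ 2 (mod 11)`, `11² ∤ 1320`), kernel-decided (`countPointsFast`). [cite: CremonaAlgorithms1997, Table 1 (707a1)] -/
theorem card_1277 :
    Nat.card (((⟨0, 1, 1, -12, 12⟩ : WeierstrassCurve ℤ).map (Int.castRingHom (ZMod 1277))).toAffine.Point) = 1320 :=
  haveI : Fact (Nat.Prime 1277) := ⟨by norm_num⟩
  natCard_point_eq_of_countPoints 0 1 1 (-12) 12 1277 (by norm_num) (by decide +kernel) (n := 1320)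
    (countPoints_eq_of_fast (by decide +kernel))

/-- **`11` is good ordinary for `707a1`** (`11 ∤ Δ`, `a_11 = -4`). [cite: CremonaAlgorithms1997, Table 1 (707a1)] -/
theorem goodOrdinary_11 :
    haveI := Fact.mk (by norm_num : Nat.Prime 11); haveI := isGloballyMinimal_c707a1;
    ((⟨0, 1, 1, -12, 12⟩ : WeierstrassCurve ℤ).map (Int.castRingHom ℚ)).HasGoodReductionAtPrime 11 ∧ ¬ ((11 : ℕ) : ℤ) ∣ ((⟨0, 1, 1, -12, 12⟩ : WeierstrassCurve ℤ).map (Int.castRingHom ℚ)).frobeniusTrace 11 := by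
  haveI := Fact.mk (by norm_num : Nat.Prime 11)
  haveI := isElliptic_c707a1
  haveI := isGloballyMinimal_c707a1
  exact goodOrdinary_of_intModel_certificate intModel 11 (by decide +kernel) (n := 16) card_11 (by decide +kernel)

/-- **`ρ̄_{E,11}` is surjective for `707a1`**: semistable (`gcd(c₄, Δ) = 1`) and `X² − (-20)X + 439` (`a_439 = -20`) has no root
mod `11` (Mazur Prop. 6.3 (1) ⟹ `E[11]` irreducible; Serre Prop. 21 ⟹ onto). [cite: Serre1972, §5.4 Prop. 21] [cite: Mazur1978, §6 Prop. 6.3 (1)] -/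
theorem hasSurjectiveModNGaloisRep_11 :
    haveI := isElliptic_c707a1;
    ((⟨0, 1, 1, -12, 12⟩ : WeierstrassCurve ℤ).map (Int.castRingHom ℚ)).HasSurjectiveModNGaloisRep (11 : ℕ) := by
  have hn : ∀ t : ZMod 11, t ^ 2 - (((439 : ℕ) : ℤ) + 1 - (460 : ℕ) : ℤ) * t + ((439 : ℕ) : ZMod 11) ≠ 0 := by
    decide +kernel
  haveI := Fact.mk (by norm_num : Nat.Prime 11); haveI := Fact.mk (by norm_num : Nat.Prime 439)
  haveI := isElliptic_c707a1; haveI := isGloballyMinimal_c707a1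
  exact hasSurjectiveModNGaloisRep_of_intModel_certificate intModel
    (by rw [Int.isCoprime_iff_gcd_eq_one]; decide +kernel) 11 439 (by norm_num) (by decide +kernel)
    (n := 460) card_439 hn

/-- **`11` is non-anomalous for `707a1`**: `a_11 − 1 = -5`. [cite: SilvermanAEC2009, VII.3 Prop. 3.1] -/
theorem nonAnomalous_11 :
    haveI := isGloballyMinimal_c707a1; haveI := Fact.mk (by norm_num : Nat.Prime 11);
    ¬ ((11 : ℕ) : ℤ) ∣ ((⟨0, 1, 1, -12, 12⟩ : WeierstrassCurve ℤ).map (Int.castRingHom ℚ)).frobeniusTrace 11 - 1 := by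
  haveI := isElliptic_c707a1; haveI := isGloballyMinimal_c707a1; haveI := Fact.mk (by norm_num : Nat.Prime 11)
  rw [IntModel.frobeniusTrace_eq intModel card_11]
  decide

/-- **`591251 = 463·1277` is a cyclic Kolyvagin level for `(707a1, 11)`** — the level of the tree record `cert_707a1` at `p = 11`.
[cite: Kim2022StructureSelmer, §1.2.2 (PDF p. 5)] -/
theorem isCyclicKolyvaginLevel_11_591251 :
    haveI := isGloballyMinimal_c707a1; haveI := Fact.mk (by norm_num : Nat.Prime 11);
    IsCyclicKolyvaginLevel ((⟨0, 1, 1, -12, 12⟩ : WeierstrassCurve ℤ).map (Int.castRingHom ℚ)) 11 591251 := by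
  haveI := isElliptic_c707a1
  haveI := isGloballyMinimal_c707a1
  haveI := Fact.mk (by norm_num : Nat.Prime 11)
  haveI : Fact (Nat.Prime 463) := ⟨by norm_num⟩
  haveI : Fact (Nat.Prime 1277) := ⟨by norm_num⟩
  have h₁ : Kato.IsKolyvaginPrime ((⟨0, 1, 1, -12, 12⟩ : WeierstrassCurve ℤ).map (Int.castRingHom ℚ)) 11 1 463 :=
    isKolyvaginPrime_of_intModel_of_card intModel 11 1 463 (by norm_num) (by decide +kernel) (by decide) card_463
      (by norm_num)
  have h₂ : Kato.IsKolyvaginPrime ((⟨0, 1, 1, -12, 12⟩ : WeierstrassCurve ℤ).map (Int.castRingHom ℚ)) 11 1 1277 :=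
    isKolyvaginPrime_of_intModel_of_card intModel 11 1 1277 (by norm_num) (by decide +kernel) (by decide) card_1277
      (by norm_num)
  refine ⟨by simpa using isKolyvaginProduct_mul h₁ h₂ (by norm_num), fun ℓ hℓ hdvd ↦ ?_⟩
  rw [show (591251 : ℕ) = 463 * 1277 from rfl] at hdvd
  rcases (Nat.Prime.dvd_mul hℓ.out).mp hdvd with h | h
  · obtain rfl := (Nat.prime_dvd_prime_iff_eq hℓ.out (by norm_num)).mp h
    exact card_torsion_le_of_intModel_of_card intModel 11 463 card_463 (by norm_num)
  · obtain rfl := (Nat.prime_dvd_prime_iff_eq hℓ.out (by norm_num)).mp h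
    exact card_torsion_le_of_intModel_of_card intModel 11 1277 card_1277 (by norm_num)

/-- **`Ш(707a1/ℚ)[11] = 0` FROM THE TREE RECORD `cert_707a1` @ `(11, 463·1277)`** (Kurihara currency): granted Kim 2026 Thm. 1.11
(`hKim`), modularity (`hnf`), Mazur 1978 Cor. 4.1 (`hMaz`) BY NAME and the record's CLAIM `hδ` (read at level `N_E` through
`KuriharaCertificates.Record.Claim`), `#Sel_11(E/ℚ) ≤ 11² = 11^rank` and so `Ш(E/ℚ)[11] = 0` (`11` good ordinary `goodOrdinary_11`,
`ρ̄_{E,11}` onto `hasSurjectiveModNGaloisRep_11`, `nonAnomalous_11`, Kodaira–Néron `kodairaNeron_of_five_le 11`, `2 ≤ rank` `KernelCerts002.C707a1.two_le_rank`).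
CONDITIONAL on the three named facts and the claim; per curve; BSD is not proved by it.
[cite: Kim2022StructureSelmer, Thm. 1.11 (PDF p. 8)] [cite: Mazur1978, Cor. 4.1] [cite: CremonaAlgorithms1997, Table 1 (707a1)] -/
theorem sha_inf_torsionBy_eq_bot_of_kuriharaClaim_11
    (hKim : Kim2022_card_selmerGroup_le_pow_of_kuriharaNumber_ne_zero)
    (hnf : exists_isNewformOf) (hMaz : mazur_not_dvd_maninConstant_of_odd)
    (hδ : haveI := isElliptic_c707a1; haveI := isGloballyMinimal_c707a1;
      haveI : NeZero (((⟨0, 1, 1, -12, 12⟩ : WeierstrassCurve ℤ).map (Int.castRingHom ℚ)).conductorNorm ℤ) := neZero_conductorNorm_of_isElliptic _;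
      haveI := Fact.mk (by norm_num : Nat.Prime 11);
      ∀ (D : ModularParametrizationData ((⟨0, 1, 1, -12, 12⟩ : WeierstrassCurve ℤ).map (Int.castRingHom ℚ)) (((⟨0, 1, 1, -12, 12⟩ : WeierstrassCurve ℤ).map (Int.castRingHom ℚ)).conductorNorm ℤ)), ¬ ((11 : ℕ) : ℤ) ∣ D.maninConstant →
        (∃ u : ℚ, ‖(u : ℚ_[11])‖ = 1 ∧ ((⟨0, 1, 1, -12, 12⟩ : WeierstrassCurve ℤ).map (Int.castRingHom ℚ)).realPeriodRat = u * plusPeriod D.f) →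
        ∃ ψ : (ℓ : ℕ) → (ZMod ℓ)ˣ →* Multiplicative (ZMod 11),
          (∀ ℓ ∈ (591251 : ℕ).primeFactors, Function.Surjective (ψ ℓ)) ∧ kuriharaNumber D.f 11 591251 ψ ≠ 0) :
    haveI := isElliptic_c707a1; haveI := isGloballyMinimal_c707a1; haveI := Fact.mk (by norm_num : Nat.Prime 11);
    (((⟨0, 1, 1, -12, 12⟩ : WeierstrassCurve ℤ).map (Int.castRingHom ℚ)).sha ⊓ AddSubgroup.torsionBy ((⟨0, 1, 1, -12, 12⟩ : WeierstrassCurve ℤ).map (Int.castRingHom ℚ)).galH1 ((11 : ℕ) : ℤ) : AddSubgroup _) = ⊥ := by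
  haveI := isElliptic_c707a1
  haveI := isGloballyMinimal_c707a1
  haveI iNZ : NeZero (((⟨0, 1, 1, -12, 12⟩ : WeierstrassCurve ℤ).map (Int.castRingHom ℚ)).conductorNorm ℤ) := neZero_conductorNorm_of_isElliptic _
  haveI := Fact.mk (by norm_num : Nat.Prime 11)
  haveI : NeZero (591251 : ℕ) := ⟨by norm_num⟩
  have hν : (591251 : ℕ).primeFactors.card ≤ ((⟨0, 1, 1, -12, 12⟩ : WeierstrassCurve ℤ).map (Int.castRingHom ℚ)).mordellWeilRank := by
    refine le_trans (le_of_eq ?_) KernelCerts002.C707a1.two_le_rank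
    rw [show (591251 : ℕ) = 463 * 1277 from rfl, Nat.primeFactors_mul (by norm_num) (by norm_num),
      Nat.Prime.primeFactors (by norm_num), Nat.Prime.primeFactors (by norm_num)]
    decide
  exact sha_inf_torsionBy_eq_bot_of_kuriharaClaim hKim hnf hMaz _ 11 (by norm_num) goodOrdinary_11.1 goodOrdinary_11.2
    hasSurjectiveModNGaloisRep_11 nonAnomalous_11 (kodairaNeron_of_five_le 11 (by norm_num)) 591251 isCyclicKolyvaginLevel_11_591251 hν hδ

end C707a1

end Summit.BirchSwinnertonDyer.BirchSwinnertonDyer.Theorems.KolyvaginDepthDoor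

end
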